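import Summits.ValiantsHypothesis.ValiantsHypothesis.Theorems.NewtonTauWeak.Negative.Zonogon

/-!
# `NewtonTauWeak` (stmt-ValiantsHypothesis-5904) — load-bearing hypothesis and shape of the bound
# (negative lane, part 2)

Sequel of `Negative/Zonogon.lean` for the crux
`Summit.ValiantsHypothesis.ValiantsHypothesis.Theses.NewtonUnitEquations.NewtonTauWeak`
(from the standing disprover's `Cruxes/NewtonTauWeak/Disproof.lean` §0'/§A/§B):

* `newtonTauWeak_iff` — the crux by name is the weak KPTT bound on `vert`; degenerate corners
  `k = 0` (`vert = 0`) and `m = 0` (`vert ≤ 1`) are harmless (no junk case);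
* `newtonTauWeak_false_without_sparsity` — with the only hypothesis `#supp f_ij ≤ t` deleted the
  statement is FALSE (`k = m = 1`, `t = 0`, one polynomial `chainPoly` with `2^a·2^b + 1` monomials on
  a strictly convex lattice chain, from `DissociatedFixedK/Negative/LoadBearing.lean`);
* `not_newtonTauBoundNoK` (`m = t = 1`, `k` monomials on the chain) and `not_newtonTauBoundNoT`
  (`k = m = 1`, one `t`-nomial): neither `k` nor `t` can be dropped from `2^{am}(kt+2)^b`
  (`m`: `not_newtonTauBoundNoM` in part 1).
[folklore]
-/

namespace Summit.ValiantsHypothesis.ValiantsHypothesis.Theorems.NewtonTauWeak.Negative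

open scoped BigOperators
open MvPolynomial Finset
open Summit.ValiantsHypothesis.ValiantsHypothesis.Theses.NewtonUnitEquations (NewtonTauWeak)
open Summit.ValiantsHypothesis.ValiantsHypothesis.Theorems.DissociatedFixedK.Negative
  (chainPt chainPoly chainPt_injective support_chainPoly vertices_chainPoly
   mem_extremePoints_convexHull_of_strict_sep emb emb_injective)

noncomputable section

/-! ## §0' Probe: the crux by name, degenerate corners -/

/-- The crux, by name, is literally the weak KPTT bound on `vert (Σ_i Π_j f i j)`. -/
theorem newtonTauWeak_iff :
    NewtonTauWeak ↔ ∃ a b : ℕ, ∀ (k m t : ℕ) (f : Fin k → Fin m → MvPolynomial (Fin 2) ℂ),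
      (∀ i j, (f i j).support.card ≤ t) → vert (∑ i, ∏ j, f i j) ≤ 2 ^ (a * m) * (k * t + 2) ^ b :=
  Iff.rfl

/-- Degenerate corner `k = 0`: the sum is `0`, no vertices (the bound is never threatened there). -/
theorem vert_sum_fin_zero (m : ℕ) (f : Fin 0 → Fin m → MvPolynomial (Fin 2) ℂ) :
    vert (∑ i, ∏ j, f i j) = 0 := by
  simp [vert]

/-- Degenerate corner `m = 0`: every product is `1`, the sum is the constant `k`, at most one vertex. -/
theorem vert_sum_fin_zero' (k : ℕ) (f : Fin k → Fin 0 → MvPolynomial (Fin 2) ℂ) :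
    vert (∑ i, ∏ j, f i j) ≤ 1 := by
  refine (vert_le_card_support _).trans ?_
  have : (∑ i : Fin k, ∏ j : Fin 0, f i j) = monomial 0 (k : ℂ) := by simp
  rw [this]
  exact (Finset.card_le_card support_monomial_subset).trans (by simp)

/-! ## §A Load-bearing: the sparsity hypothesis -/

/-- The crux with its only hypothesis `∀ i j, #supp (f i j) ≤ t` DELETED (so `t` is free). -/
def NewtonTauWeakWithoutSparsity : Prop :=
  ∃ a b : ℕ, ∀ (k m t : ℕ) (f : Fin k → Fin m → MvPolynomial (Fin 2) ℂ),
    vert (∑ i, ∏ j, f i j) ≤ 2 ^ (a * m) * (k * t + 2) ^ b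

/-- A `Fin 1 × Fin 1` sum of products is its single entry (restated for `vert`). -/
theorem sum_prod_fin_one_one (g : MvPolynomial (Fin 2) ℂ) :
    (∑ _i : Fin 1, ∏ _j : Fin 1, g) = g := by simp

/-- **Load-bearing: any proof must use the sparsity hypothesis.**  Without it take `k = m = 1`, `t = 0`
and the single factor `chainPoly (range (2^a·2^b + 1))` (monomials on a strictly convex lattice chain):
`2^a·2^b + 1` vertices against the bound `2^{a}·2^b`. -/
theorem newtonTauWeak_false_without_sparsity : ¬ NewtonTauWeakWithoutSparsity := by
  rintro ⟨a, b, h⟩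
  have hle := h 1 1 0 (fun _ _ => chainPoly (range (2 ^ a * 2 ^ b + 1)))
  rw [sum_prod_fin_one_one] at hle
  change (Set.extremePoints ℝ (convexHull ℝ ((fun e : Fin 2 →₀ ℕ => fun i : Fin 2 => ((e i : ℕ) : ℝ)) ''
      ((chainPoly (range (2 ^ a * 2 ^ b + 1))).support : Set (Fin 2 →₀ ℕ))))).ncard ≤ _ at hle
  rw [vertices_chainPoly, Finset.card_range] at hle
  have : (1 * 0 + 2) ^ b = 2 ^ b := by norm_num
  rw [this, mul_one] at hle
  omega

/-! ## §B Shape of the bound: `k` and `t` are indispensable too (`m`: `not_newtonTauBoundNoM`) -/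

/-- The weak bound with the `k`-dependence removed. -/
def NewtonTauBoundNoK : Prop :=
  ∃ a b : ℕ, ∀ (k m t : ℕ) (f : Fin k → Fin m → MvPolynomial (Fin 2) ℂ),
    (∀ i j, (f i j).support.card ≤ t) → vert (∑ i, ∏ j, f i j) ≤ 2 ^ (a * m) * (t + 2) ^ b

/-- The weak bound with the `t`-dependence removed. -/
def NewtonTauBoundNoT : Prop :=
  ∃ a b : ℕ, ∀ (k m t : ℕ) (f : Fin k → Fin m → MvPolynomial (Fin 2) ℂ),
    (∀ i j, (f i j).support.card ≤ t) → vert (∑ i, ∏ j, f i j) ≤ 2 ^ (a * m) * (k + 2) ^ b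

/-- `k` monomials `X^{n(n-1)/2} Y^n` (one per product, `m = t = 1`) sum to `chainPoly (range k)`. -/
theorem sum_monomial_chainPt (k : ℕ) :
    (∑ i : Fin k, ∏ _j : Fin 1, (monomial (chainPt (i : ℕ)) (1 : ℂ) : MvPolynomial (Fin 2) ℂ)) =
      chainPoly (range k) := by
  simp only [Finset.prod_const, Finset.card_univ, Fintype.card_fin, pow_one]
  rw [Fin.sum_univ_eq_sum_range (fun n => (monomial (chainPt n) (1 : ℂ) : MvPolynomial (Fin 2) ℂ)) k]
  rfl

/-- **`k` is indispensable**: with `m = t = 1` and `k` monomials on a strictly convex chain (one per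
summand) the vertex count is `k`, unbounded against `2^{a}·3^b`. -/
theorem not_newtonTauBoundNoK : ¬ NewtonTauBoundNoK := by
  rintro ⟨a, b, h⟩
  set K := 2 ^ a * 3 ^ b + 1 with hK
  have hle := h K 1 1 (fun i _ => monomial (chainPt (i : ℕ)) 1) (fun i j => by
    exact (Finset.card_le_card support_monomial_subset).trans (by simp))
  rw [sum_monomial_chainPt] at hle
  change (Set.extremePoints ℝ (convexHull ℝ ((fun e : Fin 2 →₀ ℕ => fun i : Fin 2 => ((e i : ℕ) : ℝ)) ''
      ((chainPoly (range K)).support : Set (Fin 2 →₀ ℕ))))).ncard ≤ _ at hle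
  rw [vertices_chainPoly, Finset.card_range] at hle
  have : (1 + 2) ^ b = 3 ^ b := by norm_num
  rw [mul_one, this] at hle
  omega

/-- **`t` is indispensable**: with `k = m = 1` and one `t`-nomial on a strictly convex chain the vertex
count is `t`, unbounded against `2^{a}·3^b`. -/
theorem not_newtonTauBoundNoT : ¬ NewtonTauBoundNoT := by
  rintro ⟨a, b, h⟩
  set N := 2 ^ a * 3 ^ b + 1 with hN
  have hle := h 1 1 N (fun _ _ => chainPoly (range N)) (fun _ _ => by
    rw [support_chainPoly, Finset.card_image_of_injective _ chainPt_injective, Finset.card_range])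
  rw [sum_prod_fin_one_one] at hle
  change (Set.extremePoints ℝ (convexHull ℝ ((fun e : Fin 2 →₀ ℕ => fun i : Fin 2 => ((e i : ℕ) : ℝ)) ''
      ((chainPoly (range N)).support : Set (Fin 2 →₀ ℕ))))).ncard ≤ _ at hle
  rw [vertices_chainPoly, Finset.card_range] at hle
  have : (1 + 2) ^ b = 3 ^ b := by norm_num
  rw [mul_one, this] at hle
  omega

end

end Summit.ValiantsHypothesis.ValiantsHypothesis.Theorems.NewtonTauWeak.Negative
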